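import Literature.NumberTheory.BeurlingPrimes.Restrict
import Literature.NumberTheory.BeurlingPrimes.RationalPrimes
import Literature.NumberTheory.BeurlingPrimes.HyperbolaLemma
import Mathlib.NumberTheory.PrimeCounting
import HarnessLib

/-!
# The systems `𝒫_{α,β} = ℙ ∪ ℙ^{1/β} ∖ 𝒫_𝒮` of Broucke–Debruyne–Révész: counting functions

Topic `Literature/NumberTheory/BeurlingPrimes`. Everything in this file is PROVED (definitions +
theorems). It assembles, for a set `S` of rational primes to be deleted and an exponent `s = 1/β`,
the Beurling system "`𝒫_{α,β} = ℙ ∪ ℙ^{1/β} ∖ 𝒫_𝒮`" of Broucke–Debruyne–Révész (arXiv:2309.01567, §5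
p. 16) — here `delSystem S hT s` — and computes its counting functions in elementary terms:

* `IsFree S n` ("`p | n ⇒ p ∉ 𝒫_𝒮`"), the indicators `freeInd S` (of the `S`-free positive integers)
  and `posInd` (of the positive integers); `delIdx S` / `keptIdx S`, the indices of the deleted / kept
  primes in the enumeration `ratPrime` of `ℙ`;
* `chebyshevPsi_delSystem : ψ_{𝒫_{α,β}}(x) = ψ(x) − ψ_𝒮(x) + s ψ(x^{1/s})` with
  `ψ_𝒮 = ratPrimes.psiOn (delIdx S)` (BDR: "`π_{α,β}(x) = π(x) + π(x^β) − π_𝒮(x)`");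
* `intCount_delSystem : N_{𝒫_{α,β}}(x) = #{(n, m) : n S-free, m ≥ 1, n m^s ≤ x}`,
  `card_eq_hypConv` : this is the hyperbola count `hypConv (freeInd S) posInd s x` of
  `HyperbolaLemma.lean`, and `hypConv_freeInd_eq_sum : = ∑_{m ≤ x^{1/s}} N'(x/m^s)` with
  `N'(y) = #{n ≤ y : n S-free} = partialSum (freeInd S) y` (`partialSum_freeInd_eq_card`);
* `primeCountIn S x = π_𝒮(x) = #{p ∈ S : p ≤ x}` and the bounds
  `(log x / 2)(π_𝒮(x) − π_𝒮(√x)) ≤ ψ_𝒮(x) ≤ π_𝒮(x) log x + (√x + 1)(log x/log 2 + 1) log x`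
  (`le_psiOn_delIdx`, `psiOn_delIdx_le`), and `θ(x) ≤ π(x) log x` in the form
  `theta_le_indexOf_mul_log`.

## References
* [BrouckeDebruyneRevesz2023] F. Broucke, G. Debruyne, Sz. Gy. Révész, *Some examples of well-behaved
  Beurling number systems*, arXiv:2309.01567 (Trans. AMS 2024), §5 pp. 15–17 (read).
-/

noncomputable section

open Filter Set
open scoped Chebyshev

namespace Literature.NumberTheory.BeurlingPrimes

open Literature.Barriers.RiemannHypothesis

variable (S : Set ℕ)

/-! ### `S`-free integers and the indicator functions -/

/-- `n` is `S`-free: no prime factor of `n` lies in `S` (BDR: "`𝒩 = {n ∈ ℕ : p | n ⇒ p ∉ 𝒫_𝒮}`").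
[cite: BrouckeDebruyneRevesz2023, §5 p. 16] -/
def IsFree (n : ℕ) : Prop := ∀ p ∈ n.primeFactors, p ∉ S

open Classical in
/-- The indicator of the `S`-free positive integers (the weight `v` of `𝒩` in the hyperbola lemma).
[cite: BrouckeDebruyneRevesz2023, §5 p. 16] -/
def freeInd (n : ℕ) : ℝ := if n ≠ 0 ∧ IsFree S n then 1 else 0

/-- The indicator of the positive integers (the weight `h ≡ 1` of `ℒ = ℕ^{1/β}`). [cite: BrouckeDebruyneRevesz2023, §5 p. 16] -/
def posInd (m : ℕ) : ℝ := if m ≠ 0 then 1 else 0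

/-- `1` is `S`-free. [folklore] -/
theorem isFree_one : IsFree S 1 := by
  intro p hp; simp at hp

/-- `freeInd S 0 = 0`. [folklore] -/
@[simp] theorem freeInd_zero : freeInd S 0 = 0 := by
  simp [freeInd]

/-- `freeInd S 1 = 1`. [folklore] -/
@[simp] theorem freeInd_one : freeInd S 1 = 1 := by
  simp [freeInd, isFree_one]

/-- `0 ≤ freeInd S n`. [folklore] -/
theorem freeInd_nonneg (n : ℕ) : 0 ≤ freeInd S n := by
  unfold freeInd; split_ifs <;> norm_num

/-- `freeInd S n ≤ 1`. [folklore] -/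
theorem freeInd_le_one (n : ℕ) : freeInd S n ≤ 1 := by
  unfold freeInd; split_ifs <;> norm_num

/-- `posInd 0 = 0`. [folklore] -/
@[simp] theorem posInd_zero : posInd 0 = 0 := by
  simp [posInd]

/-- `posInd m = 1` for `m ≠ 0`. [folklore] -/
theorem posInd_of_ne_zero {m : ℕ} (hm : m ≠ 0) : posInd m = 1 := by
  simp [posInd, hm]

/-- `0 ≤ posInd m`. [folklore] -/
theorem posInd_nonneg (m : ℕ) : 0 ≤ posInd m := by
  unfold posInd; split_ifs <;> norm_num

/-- `∑_{k ≤ t} posInd k = ⌊t⌋`. [folklore] -/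
theorem partialSum_posInd (t : ℝ) : partialSum posInd t = ⌊t⌋₊ := by
  unfold partialSum posInd
  rw [Finset.sum_ite, Finset.sum_const_zero, add_zero, Finset.sum_const, nsmul_eq_mul, mul_one]
  have h : (Finset.Icc 0 ⌊t⌋₊).filter (fun k ↦ k ≠ 0) = Finset.Icc 1 ⌊t⌋₊ := by
    ext k; simp only [Finset.mem_filter, Finset.mem_Icc]; omega
  rw [h, Nat.card_Icc, Nat.add_sub_cancel]

/-- `N'(y) = ∑_{n ≤ y} freeInd S n` counts the `S`-free positive integers `n ≤ y`. [cite: BrouckeDebruyneRevesz2023, §5 p. 16] -/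
theorem partialSum_freeInd_eq_card {y : ℝ} (hy : 0 ≤ y) :
    partialSum (freeInd S) y = Nat.card {n : ℕ // (n ≠ 0 ∧ IsFree S n) ∧ (n : ℝ) ≤ y} := by
  classical
  unfold partialSum freeInd
  rw [Finset.sum_boole]
  have e : {n : ℕ // (n ≠ 0 ∧ IsFree S n) ∧ (n : ℝ) ≤ y} ≃
      {n : ℕ // n ∈ (Finset.Icc 0 ⌊y⌋₊).filter (fun n ↦ n ≠ 0 ∧ IsFree S n)} :=
    Equiv.subtypeEquivRight fun n ↦ by
      rw [Finset.mem_filter, Finset.mem_Icc, Nat.le_floor_iff hy]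
      exact ⟨fun h ↦ ⟨⟨Nat.zero_le _, h.2⟩, h.1⟩, fun h ↦ ⟨h.2, h.1.2⟩⟩
  rw [Nat.card_congr e, Nat.card_eq_finsetCard]

/-! ### Deleted and kept primes -/

/-- The indices (in the enumeration `ratPrime` of `ℙ`) of the primes in `S` (the deleted primes
`𝒫_𝒮`). [cite: BrouckeDebruyneRevesz2023, §5 p. 16] -/
def delIdx : Set ℕ := {j | ratPrime j ∈ S}

/-- The indices of the primes not in `S` (the kept primes `ℙ ∖ 𝒫_𝒮`). [cite: BrouckeDebruyneRevesz2023, §5 p. 16] -/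
def keptIdx : Set ℕ := {j | ratPrime j ∉ S}

/-- `(keptIdx S)ᶜ = delIdx S`. [folklore] -/
theorem compl_keptIdx : (keptIdx S)ᶜ = delIdx S := by
  ext j; simp [keptIdx, delIdx]

/-- `encode k` is `S`-free iff the exponent vector `k` is supported on kept indices. [folklore] -/
theorem isFree_encode_iff (k : ℕ →₀ ℕ) : IsFree S (encode k) ↔ (k.support : Set ℕ) ⊆ keptIdx S := by
  classical
  unfold IsFree
  rw [← Nat.support_factorization, factorization_encode,
    Finsupp.mapDomain_support_of_injective ratPrime_injective]
  constructor
  · intro h j hj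
    exact h (ratPrime j) (Finset.mem_image_of_mem _ hj)
  · intro h p hp
    obtain ⟨j, hj, rfl⟩ := Finset.mem_image.mp hp
    exact h hj

/-- Exponent vectors supported on kept indices `≃` `S`-free positive integers, `k ↦ ∏ q_j^{k_j}`. [folklore] -/
def freeEquiv : {k : ℕ →₀ ℕ // (k.support : Set ℕ) ⊆ keptIdx S} ≃ {n : ℕ // n ≠ 0 ∧ IsFree S n} :=
  (Equiv.subtypeEquiv encodeEquiv (fun k ↦ (isFree_encode_iff S k).symm)).trans
    (Equiv.subtypeSubtypeEquivSubtypeInter (fun n : ℕ ↦ n ≠ 0) (fun n ↦ IsFree S n))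

/-- Reshuffling a subtype of pairs of subtypes. [folklore] -/
def subtypeProdEquiv (P Q : ℕ → Prop) (R : ℕ → ℕ → Prop) :
    {pq : {n : ℕ // P n} × {m : ℕ // Q m} // R pq.1.1 pq.2.1} ≃
      {nm : ℕ × ℕ // P nm.1 ∧ Q nm.2 ∧ R nm.1 nm.2} where
  toFun p := ⟨(p.1.1.1, p.1.2.1), p.1.1.2, p.1.2.2, p.2⟩
  invFun q := ⟨(⟨q.1.1, q.2.1⟩, ⟨q.1.2, q.2.2.1⟩), q.2.2.2⟩
  left_inv _ := rfl
  right_inv _ := rfl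

/-! ### The system `ℙ ∪ ℙ^{s} ∖ 𝒫_𝒮` -/

/-- **BDR's `𝒫_{α,β} = ℙ ∪ ℙ^{1/β} ∖ 𝒫_𝒮`** with `𝒫_𝒮 = S` and `s = 1/β`: the merge of the rational primes
not in `S` (there must be infinitely many) with the `s`-th powers of all rational primes.
[cite: BrouckeDebruyneRevesz2023, §5 p. 16] -/
def delSystem (hT : (keptIdx S).Infinite) (s : ℝ) (hs : 0 < s) : BeurlingPrimes :=
  (ratPrimes.restrict hT).merge (ratPrimes.powers s hs)

variable {S}

/-- **`ψ_{𝒫_{α,β}}(x) = ψ(x) − ψ_𝒮(x) + s ψ(x^{1/s})`** (`x ≥ 0`), `ψ_𝒮 = ratPrimes.psiOn (delIdx S)`.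
[cite: BrouckeDebruyneRevesz2023, §5 p. 16] -/
theorem chebyshevPsi_delSystem (hT : (keptIdx S).Infinite) {s : ℝ} (hs : 0 < s) {x : ℝ} (hx : 0 ≤ x) :
    (delSystem S hT s hs).chebyshevPsi x = ψ x - ratPrimes.psiOn (delIdx S) x + s * ψ (x ^ s⁻¹) := by
  unfold delSystem
  rw [BeurlingPrimes.chebyshevPsi_merge, BeurlingPrimes.chebyshevPsi_restrict,
    BeurlingPrimes.chebyshevPsi_powers _ hs hx, chebyshevPsi_ratPrimes]
  have h := ratPrimes.psiOn_add_psiOn_compl (keptIdx S) x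
  rw [compl_keptIdx, chebyshevPsi_ratPrimes] at h
  linarith

/-- **`N_{𝒫_{α,β}}(x) = #{(n, m) : n ≥ 1 S-free, m ≥ 1, n m^s ≤ x}`** (the integers are the products
of an `S`-free integer and an `s`-th power, with multiplicity). [cite: BrouckeDebruyneRevesz2023, §5 p. 16] -/
theorem intCount_delSystem (hT : (keptIdx S).Infinite) {s : ℝ} (hs : 0 < s) (x : ℝ) :
    (delSystem S hT s hs).intCount x =
      Nat.card {nm : ℕ × ℕ // (nm.1 ≠ 0 ∧ IsFree S nm.1) ∧ nm.2 ≠ 0 ∧ (nm.1 : ℝ) * (nm.2 : ℝ) ^ s ≤ x} := by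
  unfold delSystem
  rw [BeurlingPrimes.intCount_merge]
  have e1 : {kk : (ℕ →₀ ℕ) × (ℕ →₀ ℕ) //
      (ratPrimes.restrict hT).genInt kk.1 * (ratPrimes.powers s hs).genInt kk.2 ≤ x} ≃
      {pq : {n : ℕ // n ≠ 0 ∧ IsFree S n} × {m : ℕ // m ≠ 0} //
        ((pq.1.1 : ℕ) : ℝ) * ((pq.2.1 : ℕ) : ℝ) ^ s ≤ x} :=
    Equiv.subtypeEquiv (Equiv.prodCongr ((restrictExpEquiv hT).trans (freeEquiv S)) encodeEquiv) fun kk ↦ by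
      obtain ⟨k₁, k₂⟩ := kk
      rw [BeurlingPrimes.genInt_restrict, BeurlingPrimes.genInt_powers, genInt_ratPrimes, genInt_ratPrimes]
      exact Iff.rfl
  exact Nat.card_congr (e1.trans (subtypeProdEquiv (fun n ↦ n ≠ 0 ∧ IsFree S n) (fun m ↦ m ≠ 0)
    (fun n m ↦ (n : ℝ) * (m : ℝ) ^ s ≤ x)))

/-- The same count is the hyperbola count of `HyperbolaLemma.lean` with `v = freeInd S`, `h = posInd`
(`s ≥ 1`). [cite: BrouckeDebruyneRevesz2023, §5 p. 16] -/
theorem card_eq_hypConv (S : Set ℕ) {s : ℝ} (hs : 1 ≤ s) (x : ℝ) :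
    (Nat.card {nm : ℕ × ℕ // (nm.1 ≠ 0 ∧ IsFree S nm.1) ∧ nm.2 ≠ 0 ∧ (nm.1 : ℝ) * (nm.2 : ℝ) ^ s ≤ x} : ℝ)
      = hypConv (freeInd S) posInd s x := by
  classical
  have hs0 : 0 < s := by linarith
  set B : Finset ℕ := Finset.Icc 0 ⌊x⌋₊ with hB
  let Pred : ℕ × ℕ → Prop := fun nm ↦ (nm.1 ≠ 0 ∧ IsFree S nm.1) ∧ nm.2 ≠ 0 ∧ (nm.1 : ℝ) * (nm.2 : ℝ) ^ s ≤ x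
  -- members of the subtype lie in the box
  have hbox : ∀ nm : ℕ × ℕ, Pred nm → nm ∈ B ×ˢ B := by
    rintro ⟨n, m⟩ ⟨⟨hn0, -⟩, hm0, hle⟩
    have hn1 : (1 : ℝ) ≤ n := by exact_mod_cast Nat.one_le_iff_ne_zero.mpr hn0
    have hm1 : (1 : ℝ) ≤ m := by exact_mod_cast Nat.one_le_iff_ne_zero.mpr hm0
    have hms1 : (1 : ℝ) ≤ (m : ℝ) ^ s := Real.one_le_rpow hm1 hs0.le
    have hnx : (n : ℝ) ≤ x := le_trans (by nlinarith) hle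
    have hmx : (m : ℝ) ≤ x := by
      calc (m : ℝ) ≤ (m : ℝ) ^ s := Real.self_le_rpow_of_one_le hm1 hs
        _ ≤ (n : ℝ) * (m : ℝ) ^ s := by nlinarith
        _ ≤ x := hle
    simp only [hB, Finset.mem_product, Finset.mem_Icc, Nat.zero_le, true_and]
    exact ⟨Nat.le_floor hnx, Nat.le_floor hmx⟩
  have e : {nm : ℕ × ℕ // Pred nm} ≃ {nm : ℕ × ℕ // nm ∈ (B ×ˢ B).filter Pred} :=
    Equiv.subtypeEquivRight fun nm ↦ by
      rw [Finset.mem_filter]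
      exact ⟨fun h ↦ ⟨hbox nm h, h⟩, fun h ↦ h.2⟩
  have hcard : Nat.card {nm : ℕ × ℕ // Pred nm} = ((B ×ˢ B).filter Pred).card := by
    rw [Nat.card_congr e, Nat.card_eq_finsetCard]
  -- the hyperbola count is the same cardinality
  have hsum : hypConv (freeInd S) posInd s x = ∑ nm ∈ B ×ˢ B, if Pred nm then (1 : ℝ) else 0 := by
    unfold hypConv
    rw [← hB, Finset.sum_product]
    refine Finset.sum_congr rfl fun n _ ↦ Finset.sum_congr rfl fun m _ ↦ ?_
    unfold freeInd posInd
    by_cases hR : (n : ℝ) * (m : ℝ) ^ s ≤ x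
    · by_cases hP : n ≠ 0 ∧ IsFree S n
      · by_cases hQ : m ≠ 0
        · rw [if_pos hR, if_pos hP, if_pos hQ, if_pos ⟨hP, hQ, hR⟩, mul_one]
        · rw [if_pos hR, if_neg hQ, mul_zero, if_neg (fun h ↦ hQ h.2.1)]
      · rw [if_pos hR, if_neg hP, zero_mul, if_neg (fun h ↦ hP h.1)]
    · rw [if_neg hR, if_neg (fun h ↦ hR h.2.2)]
  change (Nat.card {nm : ℕ × ℕ // Pred nm} : ℝ) = _
  rw [hcard, hsum, Finset.sum_boole]

/-- **`N_{𝒫_{α,β}}(x) = ∑_{m ≤ x^{1/s}} N'(x/m^s)`** as a hyperbola count: for `x ≥ 1`,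
`hypConv (freeInd S) posInd s x = ∑_{m ≤ x^{1/s}} posInd m · N'(x/m^s)` with
`N'(y) = partialSum (freeInd S) y` (the hyperbola identity with `y = 1`; BDR, case `β = 2α/(α+2)`:
"`N_{α,β}(x) = ∑_{m ≤ x, m ∈ ℕ^{1/β}} (x/(m ζ_𝒮(1)) + O(…))`"). [cite: BrouckeDebruyneRevesz2023, §5 p. 17] -/
theorem hypConv_freeInd_eq_sum (S : Set ℕ) {s : ℝ} (hs : 1 ≤ s) {x : ℝ} (hx : 1 ≤ x) :
    hypConv (freeInd S) posInd s x =
      ∑ m ∈ Finset.Icc 0 ⌊x ^ s⁻¹⌋₊, posInd m * partialSum (freeInd S) (x / (m : ℝ) ^ s) := by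
  have h := hypConv_eq (freeInd S) posInd s (freeInd_zero S) posInd_zero hs le_rfl hx
  rw [h, Nat.floor_one, div_one]
  have h01 : Finset.Icc 0 1 = ({0, 1} : Finset ℕ) := by decide
  have hps : partialSum (freeInd S) 1 = 1 := by
    unfold partialSum
    rw [Nat.floor_one, h01, Finset.sum_pair (by norm_num)]
    simp
  rw [h01, Finset.sum_pair (by norm_num), hps]
  simp

/-! ### `π_𝒮` and the size of `ψ_𝒮` -/

/-- `π_𝒮(x) = #{p ∈ S : p ≤ x}`. [cite: BrouckeDebruyneRevesz2023, §5 p. 16] -/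
def primeCountIn (S : Set ℕ) (x : ℝ) : ℕ := Nat.card {p : ℕ // p ∈ S ∧ (p : ℝ) ≤ x}

/-- For ratPrimes, `indexOf y ≤ ⌊y⌋ + 1` (since `q_j ≥ j`). [folklore] -/
theorem indexOf_ratPrimes_le (y : ℝ) : ratPrimes.indexOf y ≤ ⌊y⌋₊ + 1 := by
  by_contra h
  push Not at h
  have h1 : ratPrimes.prime (⌊y⌋₊ + 1) ≤ y := ratPrimes.prime_le_iff.mpr h
  rw [ratPrimes_prime] at h1
  have h2 : ((⌊y⌋₊ + 1 : ℕ) : ℝ) ≤ ratPrime (⌊y⌋₊ + 1) := by exact_mod_cast le_ratPrime _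
  have h3 : y < (⌊y⌋₊ : ℝ) + 1 := Nat.lt_floor_add_one y
  push_cast at h2
  linarith

open Classical in
/-- The indices `j < π(y)` of primes in `S` are in bijection with `{p ∈ S : p ≤ y}` (all elements of
`S` being prime). [folklore] -/
theorem card_filter_delIdx (hS : ∀ p ∈ S, p.Prime) (y : ℝ) :
    ((Finset.range (ratPrimes.indexOf y)).filter (fun j ↦ j ∈ delIdx S)).card = primeCountIn S y := by
  classical
  unfold primeCountIn
  rw [← Nat.card_eq_finsetCard]
  refine Nat.card_congr ?_
  refine Equiv.ofBijective (fun j ↦ ⟨ratPrime j.1, ?_⟩) ⟨?_, ?_⟩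
  · have hj := Finset.mem_filter.mp j.2
    refine ⟨hj.2, ?_⟩
    have := ratPrimes.prime_le_iff.mpr (Finset.mem_range.mp hj.1)
    rwa [ratPrimes_prime] at this
  · intro a b hab
    have h := Subtype.ext_iff.mp hab
    exact Subtype.ext (ratPrime_injective h)
  · intro p
    have hp : (p.1).Prime := hS p.1 p.2.1
    refine ⟨⟨Nat.count Nat.Prime p.1, Finset.mem_filter.mpr ⟨?_, ?_⟩⟩, ?_⟩
    · rw [Finset.mem_range, ← ratPrimes.prime_le_iff, ratPrimes_prime, ratPrime_count hp]
      exact p.2.2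
    · show ratPrime (Nat.count Nat.Prime p.1) ∈ S
      rw [ratPrime_count hp]; exact p.2.1
    · exact Subtype.ext (ratPrime_count hp)

open Classical in
/-- `ψ_𝒮(x)` as a double sum over `j < π(x)`, `k < expBound x`. [folklore] -/
theorem psiOn_delIdx_eq_sum (x : ℝ) : ratPrimes.psiOn (delIdx S) x =
    ∑ j ∈ Finset.range (ratPrimes.indexOf x), ∑ k ∈ Finset.range (ratPrimes.expBound x),
      if j ∈ delIdx S then ratPrimes.psiTerm x (j, k) else 0 := by
  classical
  rw [ratPrimes.psiOn_eq_sum, BeurlingPrimes.psiSupport, Finset.sum_product]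
  refine Finset.sum_congr rfl fun j _ ↦ Finset.sum_congr rfl fun k _ ↦ ?_
  simp only [Set.indicator_apply, Set.mem_setOf_eq]

/-- The `k = 0` slice of `ψ_𝒮(x)`: `ϑ_𝒮(x) = ∑_{j < π(x), q_j ∈ S} log q_j`. [folklore] -/
theorem psiTerm_ratPrimes_zero {x : ℝ} {j : ℕ} (hj : j < ratPrimes.indexOf x) :
    ratPrimes.psiTerm x (j, 0) = Real.log (ratPrime j) := by
  unfold BeurlingPrimes.psiTerm
  have h : ratPrimes.prime j ≤ x := ratPrimes.prime_le_iff.mpr hj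
  rw [if_pos (by simpa using h), ratPrimes_prime]

/-- **Upper bound for `ψ_𝒮`**: `ψ_𝒮(x) ≤ π_𝒮(x) log x + (√x + 1) · expBound(x) · log x` for `x ≥ 1`
(the prime powers `q^{k+1} ≤ x` with `k ≥ 1` have `q ≤ √x`). [cite: BrouckeDebruyneRevesz2023, §5 p. 16] -/
theorem psiOn_delIdx_le (hS : ∀ p ∈ S, p.Prime) {x : ℝ} (hx : 1 ≤ x) :
    ratPrimes.psiOn (delIdx S) x ≤
      primeCountIn S x * Real.log x + (Real.sqrt x + 1) * (ratPrimes.expBound x) * Real.log x := by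
  classical
  have hx0 : 0 ≤ x := by linarith
  have hlogx : 0 ≤ Real.log x := Real.log_nonneg hx
  rw [psiOn_delIdx_eq_sum]
  -- split off `k = 0`
  have hsplit0 : ∀ f : ℕ → ℝ, ∑ k ∈ Finset.range (ratPrimes.expBound x), f k =
      ∑ k ∈ Finset.range (ratPrimes.expBound x - 1), f (k + 1) + f 0 := by
    intro f
    have hE : ratPrimes.expBound x = (ratPrimes.expBound x - 1) + 1 := by
      unfold BeurlingPrimes.expBound; omega
    conv_lhs => rw [hE]
    exact Finset.sum_range_succ' f _
  simp_rw [hsplit0]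
  rw [Finset.sum_add_distrib]
  -- the terms
  have hterm_le : ∀ j k : ℕ, ratPrimes.psiTerm x (j, k) ≤ Real.log x := by
    intro j k
    unfold BeurlingPrimes.psiTerm
    split_ifs with h
    · refine Real.log_le_log (ratPrimes.prime_pos _) ?_
      exact le_trans (le_self_pow₀ (ratPrimes.one_lt_prime _).le (Nat.succ_ne_zero _)) h
    · exact hlogx
  have hterm_nn : ∀ j k : ℕ, 0 ≤ ratPrimes.psiTerm x (j, k) := fun j k ↦ ratPrimes.psiTerm_nonneg x (j, k)
  -- (1) the `k ≥ 1` part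
  have h1 : ∑ j ∈ Finset.range (ratPrimes.indexOf x), ∑ k ∈ Finset.range (ratPrimes.expBound x - 1),
      (if j ∈ delIdx S then ratPrimes.psiTerm x (j, k + 1) else 0) ≤
      (Real.sqrt x + 1) * (ratPrimes.expBound x) * Real.log x := by
    -- only `j < indexOf √x` contribute
    have hvan : ∀ j ∈ Finset.range (ratPrimes.indexOf x), ratPrimes.indexOf (Real.sqrt x) ≤ j →
        ∀ k : ℕ, (if j ∈ delIdx S then ratPrimes.psiTerm x (j, k + 1) else 0) = 0 := by
      intro j _ hj k
      have hq : Real.sqrt x < ratPrimes.prime j := by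
        by_contra hc; push Not at hc
        exact absurd (ratPrimes.prime_le_iff.mp hc) (not_lt.mpr hj)
      have hterm : ratPrimes.psiTerm x (j, k + 1) = 0 := by
        unfold BeurlingPrimes.psiTerm
        rw [if_neg]
        intro hle
        have h2 : ratPrimes.prime j ^ 2 ≤ ratPrimes.prime j ^ (k + 1 + 1) :=
          pow_le_pow_right₀ (ratPrimes.one_lt_prime _).le (by omega)
        have h3 : Real.sqrt x ^ 2 < ratPrimes.prime j ^ 2 := by
          exact pow_lt_pow_left₀ hq (Real.sqrt_nonneg x) two_ne_zero
        rw [Real.sq_sqrt hx0] at h3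
        linarith
      simp [hterm]
    have hsplit : ∑ j ∈ Finset.range (ratPrimes.indexOf x), ∑ k ∈ Finset.range (ratPrimes.expBound x - 1),
        (if j ∈ delIdx S then ratPrimes.psiTerm x (j, k + 1) else 0) =
        ∑ j ∈ Finset.range (min (ratPrimes.indexOf (Real.sqrt x)) (ratPrimes.indexOf x)),
          ∑ k ∈ Finset.range (ratPrimes.expBound x - 1),
            (if j ∈ delIdx S then ratPrimes.psiTerm x (j, k + 1) else 0) := by
      symm
      refine Finset.sum_subset (fun j hj ↦ ?_) (fun j hj hj' ↦ ?_)
      · simp only [Finset.mem_range, lt_min_iff] at hj ⊢; exact hj.2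
      · simp only [Finset.mem_range, lt_min_iff, not_and_or, not_lt] at hj hj'
        rcases hj' with h | h
        · exact Finset.sum_eq_zero fun k _ ↦ hvan j (Finset.mem_range.mpr hj) h k
        · exact absurd hj (not_lt.mpr h)
    rw [hsplit]
    have hbd : ∀ j ∈ Finset.range (min (ratPrimes.indexOf (Real.sqrt x)) (ratPrimes.indexOf x)),
        ∑ k ∈ Finset.range (ratPrimes.expBound x - 1),
          (if j ∈ delIdx S then ratPrimes.psiTerm x (j, k + 1) else 0) ≤ (ratPrimes.expBound x) * Real.log x := by
      intro j _
      calc ∑ k ∈ Finset.range (ratPrimes.expBound x - 1), (if j ∈ delIdx S then ratPrimes.psiTerm x (j, k + 1) else 0)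
          ≤ ∑ k ∈ Finset.range (ratPrimes.expBound x - 1), Real.log x := by
            refine Finset.sum_le_sum fun k _ ↦ ?_
            split_ifs
            · exact hterm_le j (k + 1)
            · exact hlogx
        _ = (ratPrimes.expBound x - 1 : ℕ) * Real.log x := by rw [Finset.sum_const, Finset.card_range, nsmul_eq_mul]
        _ ≤ (ratPrimes.expBound x) * Real.log x := by
            refine mul_le_mul_of_nonneg_right ?_ hlogx
            exact_mod_cast Nat.sub_le _ _
    refine (Finset.sum_le_sum hbd).trans ?_
    rw [Finset.sum_const, Finset.card_range, nsmul_eq_mul]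
    have hmin : ((min (ratPrimes.indexOf (Real.sqrt x)) (ratPrimes.indexOf x) : ℕ) : ℝ) ≤ Real.sqrt x + 1 := by
      calc ((min (ratPrimes.indexOf (Real.sqrt x)) (ratPrimes.indexOf x) : ℕ) : ℝ)
          ≤ (ratPrimes.indexOf (Real.sqrt x) : ℝ) := by exact_mod_cast min_le_left _ _
        _ ≤ ((⌊Real.sqrt x⌋₊ + 1 : ℕ) : ℝ) := by exact_mod_cast indexOf_ratPrimes_le _
        _ ≤ Real.sqrt x + 1 := by push_cast; linarith [Nat.floor_le (Real.sqrt_nonneg x)]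
    have hEl : 0 ≤ (ratPrimes.expBound x : ℝ) * Real.log x := mul_nonneg (Nat.cast_nonneg _) hlogx
    calc ((min (ratPrimes.indexOf (Real.sqrt x)) (ratPrimes.indexOf x) : ℕ) : ℝ) * ((ratPrimes.expBound x) * Real.log x)
        ≤ (Real.sqrt x + 1) * ((ratPrimes.expBound x) * Real.log x) := mul_le_mul_of_nonneg_right hmin hEl
      _ = (Real.sqrt x + 1) * (ratPrimes.expBound x) * Real.log x := by ring
  -- (2) the `k = 0` part
  have h2 : ∑ j ∈ Finset.range (ratPrimes.indexOf x), (if j ∈ delIdx S then ratPrimes.psiTerm x (j, 0) else 0) ≤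
      primeCountIn S x * Real.log x := by
    rw [← card_filter_delIdx hS x, ← Finset.sum_filter]
    calc ∑ j ∈ (Finset.range (ratPrimes.indexOf x)).filter (fun j ↦ j ∈ delIdx S), ratPrimes.psiTerm x (j, 0)
        ≤ ∑ j ∈ (Finset.range (ratPrimes.indexOf x)).filter (fun j ↦ j ∈ delIdx S), Real.log x :=
          Finset.sum_le_sum fun j _ ↦ hterm_le j 0
      _ = _ := by rw [Finset.sum_const, nsmul_eq_mul]
  linarith

/-- **Lower bound for `ψ_𝒮`**: `(log x / 2) (π_𝒮(x) − π_𝒮(√x)) ≤ ψ_𝒮(x)` for `x ≥ 1` (the primes of `S`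
in `(√x, x]` each contribute at least `log √x`). [cite: BrouckeDebruyneRevesz2023, §5 p. 16] -/
theorem le_psiOn_delIdx (hS : ∀ p ∈ S, p.Prime) {x : ℝ} (hx : 1 ≤ x) :
    (Real.log x / 2) * ((primeCountIn S x : ℝ) - primeCountIn S (Real.sqrt x)) ≤ ratPrimes.psiOn (delIdx S) x := by
  classical
  have hx0 : 0 ≤ x := by linarith
  have hlogx : 0 ≤ Real.log x := Real.log_nonneg hx
  have hterm_nn : ∀ j k : ℕ, 0 ≤ (if j ∈ delIdx S then ratPrimes.psiTerm x (j, k) else 0) := by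
    intro j k; split_ifs
    · exact ratPrimes.psiTerm_nonneg x (j, k)
    · exact le_rfl
  -- keep only `k = 0`
  have h1 : ∑ j ∈ Finset.range (ratPrimes.indexOf x), (if j ∈ delIdx S then ratPrimes.psiTerm x (j, 0) else 0) ≤
      ratPrimes.psiOn (delIdx S) x := by
    rw [psiOn_delIdx_eq_sum]
    refine Finset.sum_le_sum fun j _ ↦ ?_
    have hE : 0 < ratPrimes.expBound x := by unfold BeurlingPrimes.expBound; omega
    rw [← Finset.sum_range_add_sum_Ico _ (Nat.one_le_iff_ne_zero.mpr hE.ne'), Finset.sum_range_one]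
    have : 0 ≤ ∑ k ∈ Finset.Ico 1 (ratPrimes.expBound x), (if j ∈ delIdx S then ratPrimes.psiTerm x (j, k) else 0) :=
      Finset.sum_nonneg fun k _ ↦ hterm_nn j k
    linarith
  refine le_trans ?_ h1
  -- the `k = 0` sum over `j ∈ [π(√x), π(x))` with `j ∈ delIdx`
  set A := ratPrimes.indexOf (Real.sqrt x) with hA
  set Bx := ratPrimes.indexOf x with hBx
  have hsx : Real.sqrt x ≤ x := by
    nlinarith [Real.mul_self_sqrt hx0, Real.one_le_sqrt.mpr hx, Real.sqrt_nonneg x]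
  have hAB : A ≤ Bx := ratPrimes.indexOf_mono hsx
  rw [← Finset.sum_range_add_sum_Ico _ hAB]
  have hfirst : 0 ≤ ∑ j ∈ Finset.range A, (if j ∈ delIdx S then ratPrimes.psiTerm x (j, 0) else 0) :=
    Finset.sum_nonneg fun j _ ↦ hterm_nn j 0
  have hcard : ((((Finset.Ico A Bx).filter (fun j ↦ j ∈ delIdx S)).card : ℕ) : ℝ) =
      (primeCountIn S x : ℝ) - primeCountIn S (Real.sqrt x) := by
    rw [← card_filter_delIdx hS x, ← card_filter_delIdx hS (Real.sqrt x), ← hA, ← hBx]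
    have hdisj : Disjoint ((Finset.range A).filter (fun j ↦ j ∈ delIdx S))
        ((Finset.Ico A Bx).filter (fun j ↦ j ∈ delIdx S)) := by
      refine Finset.disjoint_left.mpr fun j hj1 hj2 ↦ ?_
      simp only [Finset.mem_filter, Finset.mem_range, Finset.mem_Ico] at hj1 hj2
      omega
    have hunion : (Finset.range Bx).filter (fun j ↦ j ∈ delIdx S) =
        (Finset.range A).filter (fun j ↦ j ∈ delIdx S) ∪ (Finset.Ico A Bx).filter (fun j ↦ j ∈ delIdx S) := by
      rw [← Finset.filter_union, Finset.range_eq_Ico, Finset.range_eq_Ico,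
        Finset.Ico_union_Ico_eq_Ico (Nat.zero_le A) hAB]
    rw [hunion, Finset.card_union_of_disjoint hdisj]
    push_cast
    ring
  have hsecond : (Real.log x / 2) * ((primeCountIn S x : ℝ) - primeCountIn S (Real.sqrt x)) ≤
      ∑ j ∈ Finset.Ico A Bx, (if j ∈ delIdx S then ratPrimes.psiTerm x (j, 0) else 0) := by
    rw [← hcard, ← Finset.sum_filter]
    calc (Real.log x / 2) * ((((Finset.Ico A Bx).filter (fun j ↦ j ∈ delIdx S)).card : ℕ) : ℝ)
        = ∑ j ∈ (Finset.Ico A Bx).filter (fun j ↦ j ∈ delIdx S), Real.log x / 2 := by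
          rw [Finset.sum_const, nsmul_eq_mul, mul_comm]
      _ ≤ ∑ j ∈ (Finset.Ico A Bx).filter (fun j ↦ j ∈ delIdx S), ratPrimes.psiTerm x (j, 0) := by
          refine Finset.sum_le_sum fun j hj ↦ ?_
          have hj' := Finset.mem_filter.mp hj
          have hjI := Finset.mem_Ico.mp hj'.1
          rw [psiTerm_ratPrimes_zero hjI.2]
          have hq : Real.sqrt x < ratPrime j := by
            by_contra hc
            push Not at hc
            have : ratPrimes.prime j ≤ Real.sqrt x := by rwa [ratPrimes_prime]
            exact absurd (ratPrimes.prime_le_iff.mp this) (not_lt.mpr hjI.1)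
          have hsq0 : 0 < Real.sqrt x := Real.sqrt_pos.mpr (by linarith)
          rw [← Real.log_sqrt hx0]
          exact Real.log_le_log hsq0 hq.le
  linarith

/-! ### `π(x)` for ratPrimes and Chebyshev's `ϑ(x) ≤ π(x) log x` -/

/-- For ratPrimes, `indexOf x = #{primes ≤ x} = Nat.count Nat.Prime (⌊x⌋ + 1) = π(⌊x⌋)`. [folklore] -/
theorem indexOf_ratPrimes_eq_count (x : ℝ) : ratPrimes.indexOf x = Nat.count Nat.Prime (⌊x⌋₊ + 1) := by
  have key : ∀ j, j < ratPrimes.indexOf x ↔ j < Nat.count Nat.Prime (⌊x⌋₊ + 1) := by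
    intro j
    rw [← ratPrimes.prime_le_iff, ratPrimes_prime, Nat.lt_nth_iff_count_lt Nat.infinite_setOf_prime,
      Nat.lt_add_one_iff]
    show ((Nat.nth Nat.Prime j : ℕ) : ℝ) ≤ x ↔ Nat.nth Nat.Prime j ≤ ⌊x⌋₊
    constructor
    · intro h; exact Nat.le_floor h
    · intro h
      rcases le_or_gt 0 x with hx | hx
      · exact le_trans (by exact_mod_cast h) (Nat.floor_le hx)
      · rw [Nat.floor_of_nonpos hx.le] at h
        exact absurd h (not_le.mpr (prime_ratPrime j).pos)
  by_contra hne
  rcases Nat.lt_or_gt_of_ne hne with h | h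
  · exact lt_irrefl _ ((key _).mpr h)
  · exact lt_irrefl _ ((key _).mp h)

/-- **`ϑ(x) ≤ π(x) log x`** with `π(x) = ratPrimes.indexOf x` (Mathlib's `Chebyshev.theta_le_pi_mul_log'`).
[folklore] -/
theorem theta_le_indexOf_mul_log (x : ℝ) : θ x ≤ (ratPrimes.indexOf x : ℝ) * Real.log x := by
  have h := Chebyshev.theta_le_pi_mul_log' x
  have e : Nat.primeCounting ⌊x⌋₊ = ratPrimes.indexOf x := by
    rw [indexOf_ratPrimes_eq_count]; rfl
  rwa [e] at h

end Literature.NumberTheory.BeurlingPrimes
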